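import Mathlib.NumberTheory.ModularForms.CongruenceSubgroups
import Mathlib.RingTheory.Localization.Away.Basic
import Mathlib.LinearAlgebra.Matrix.SpecialLinearGroup
import Literature.NumberTheory.EllipticCurves.Gamma0CocycleDegeneracyMaps

/-!
# Sketch — crux idea `fw-solenoid` on `PrintX11a.UpperNonSurjFive` (item stmt-BirchSwinnertonDyer-20614)

Lens: transfer (Ferrero–Washington ↦ cusp labels of non-congruence `ℤ/p`-covers of `X₀(pM)`).
Typed here: the two PROVABLE supports of the line (Lemma E = Kurth–Long 2008 Prop. 3.2 transposed to
`Γ₀`; NonExtension = CSP for `SL₂(ℤ[1/p])` (tree: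
`Literature.NumberTheory.Automorphic.SerreSL2Congruence1970_congruenceSubgroupProperty_away_holds`)
+ Lemma E), and the Hecke-transport relation the mixing step is about.  Nothing is proved here.
BSD is not proved; no summit statement is proved by this seat.
-/

open CongruenceSubgroup Matrix MatrixGroups

namespace Summit.BirchSwinnertonDyer.BirchSwinnertonDyer.Cruxes.UpperNonSurjFive.FwSolenoid

/-- `χ : Γ₀(N) → F` kills `Γ(L) ∩ Γ₀(N)` ("congruence-trivial at level `L`"). -/
def IsCongruenceTrivial {F : Type*} [Group F] (N L : ℕ) (χ : Gamma0 N →* F) : Prop :=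
  ∀ γ : Gamma0 N, (γ : SL(2, ℤ)) ∈ Gamma L → χ γ = 1

/-- Kurth–Long *type II*: `χ` kills every element of trace `±2` of `Γ₀(N)` (parabolics and `±1`);
homology characters `Γ₀(N) → H₁(X₀(N); 𝔽_p) → 𝔽_p` are of this kind. -/
def IsTypeII {F : Type*} [Group F] (N : ℕ) (χ : Gamma0 N →* F) : Prop :=
  ∀ γ : Gamma0 N,
    ((γ : SL(2, ℤ)) 0 0 + (γ : SL(2, ℤ)) 1 1 = 2 ∨ (γ : SL(2, ℤ)) 0 0 + (γ : SL(2, ℤ)) 1 1 = -2) →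
      χ γ = 1

/-- `χ` is *Eisenstein* (a `d`-entry character): it kills `Γ₁(N) = ker (Gamma0Map N)`. -/
def IsEisenstein {F : Type*} [Group F] (N : ℕ) (χ : Gamma0 N →* F) : Prop :=
  ∀ γ : Gamma0 N, γ ∈ Gamma1' N → χ γ = 1

/-- **Lemma E** (Kurth–Long, *On modular forms for some noncongruence subgroups of SL₂(ℤ)*,
J. Number Theory 128 (2008), Prop. 3.2, stated there for `Γ⁰(n)`; transpose): a type-II homomorphism
on `Γ₀(N)` with congruence kernel is Eisenstein.  Equivalently: the cuspidal `𝔽_p`-homology characters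
of `Γ₀(N)` have NON-congruence kernels.  [support, M-sized; Wohlfahrt's level theorem or, for
`p ≥ 5`, an abelianisation computation in `SL₂(ℤ/L)`.] -/
def LemmaE (N : ℕ) : Prop :=
  ∀ (F : Type) [Group F] [Finite F] (χ : Gamma0 N →* F) (L : ℕ), 0 < L →
    IsTypeII N χ → IsCongruenceTrivial N L χ → IsEisenstein N χ

/-- `ℤ[1/p]`. -/
abbrev Away (p : ℕ) : Type := Localization.Away ((p : ℕ) : ℤ)

/-- `SL₂(ℤ) → SL₂(ℤ[1/p])`. -/
noncomputable def toAway (p : ℕ) : SL(2, ℤ) →* SL(2, Away p) :=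
  Matrix.SpecialLinearGroup.map (algebraMap ℤ (Away p))

/-- `Γ₀(M; ℤ[1/p]) = {g ∈ SL₂(ℤ[1/p]) : c(g) ∈ M·ℤ[1/p]}` — the `p`-arithmetic (Ihara) saturation of
`Γ₀(pM)`: the group generated by `Γ₀(pM)` and its conjugates by powers of `diag(1, p)`. -/
noncomputable def Gamma0Away (p M : ℕ) : Subgroup SL(2, Away p) where
  carrier := {g | (g : Matrix (Fin 2) (Fin 2) (Away p)) 1 0 ∈ Ideal.span {((M : ℤ) : Away p)}}
  mul_mem' := by
    intro a b ha hb
    simp only [Set.mem_setOf_eq, Matrix.SpecialLinearGroup.coe_mul, Matrix.mul_apply,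
      Fin.sum_univ_two] at *
    exact Ideal.add_mem _ (Ideal.mul_mem_right _ _ ha) (Ideal.mul_mem_left _ _ hb)
  one_mem' := by simp
  inv_mem' := by
    intro a ha
    simp only [Set.mem_setOf_eq] at ha ⊢
    rw [Matrix.SpecialLinearGroup.coe_inv, Matrix.adjugate_fin_two]
    simpa using neg_mem ha

/-- **NonExtension** (Ihara form of CSP): a type-II homomorphism on `Γ₀(pM)` with finite target that
EXTENDS to the `p`-arithmetic saturation `Γ₀(M; ℤ[1/p])` is Eisenstein.  Proof route (M-sized, all
inputs in tree or Lemma E): `ker χ̃` has finite index in `SL₂(ℤ[1/p])`, so by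
`SerreSL2Congruence1970_congruenceSubgroupProperty_away_holds` it contains a principal congruence
subgroup (`p ≥ 2`, `M ≥ 1`: CSP needs a unit of infinite order; at `p = 1` the statement would be false,
whence the guard); pull back along `toAway` ⇒ `χ` congruence-trivial ⇒ Lemma E.  Contrapositive = the ENGINE of
the line: a cuspidal label is NOT transported consistently by the `U_p`-tree (the label cocycle of the
cover `X_χ → X₀(pM)` over the Hecke solenoid is not a coboundary). -/
def NonExtension (p M : ℕ) : Prop :=
  2 ≤ p → 0 < M → ∀ (F : Type) [Group F] [Finite F] (χ : Gamma0 (p * M) →* F),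
    IsTypeII (p * M) χ →
    (∃ χ' : Gamma0Away p M →* F,
        ∀ (γ : Gamma0 (p * M)) (h : toAway p (γ : SL(2, ℤ)) ∈ Gamma0Away p M), χ' ⟨_, h⟩ = χ γ) →
      IsEisenstein (p * M) χ

/-- `δ = α_k⁻¹ γ α_k` with `α_k = diag(1, p^k)`, written entrywise inside `SL₂(ℤ)`
(`δ = (a, p^k b; c/p^k, d)`): the relation moved along by the `k`-th Hecke correspondence at `p`. -/
def IsHeckeConjugate (p k : ℕ) (γ δ : SL(2, ℤ)) : Prop :=
  δ 0 0 = γ 0 0 ∧ δ 1 1 = γ 1 1 ∧ δ 0 1 = (p : ℤ) ^ k * γ 0 1 ∧ (p : ℤ) ^ k * δ 1 0 = γ 1 0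

/-- `χ` takes equal values on Hecke-conjugate elements of `Γ₀(N)` (all `k`).  An extendable `χ`
(NonExtension's hypothesis) has this property; the mixing step of the line needs the quantitative
failure of it for cuspidal `χ` along the tree of cusps `v/pⁿ` above `[1/p]`. -/
def IsHeckeTransported {F : Type*} [Group F] (p N : ℕ) (χ : Gamma0 N →* F) : Prop :=
  ∀ (k : ℕ) (γ δ : Gamma0 N), IsHeckeConjugate p k γ δ → χ γ = χ δ

/-- FIRST LEMMA of the line as one signature (the typed, provable part): Lemma E at level `pM` and
NonExtension at `(p, M)`. -/
def FirstLemma (p M : ℕ) : Prop := LemmaE (p * M) ∧ NonExtension p M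

example : FirstLemma 5 3 ↔ LemmaE 15 ∧ NonExtension 5 3 := Iff.rfl


/-! ## v2: the algebraic half is Ihara's lemma mod p (group form)

`Γ₀(pM; ℤ[1/p]) = Γ₀(M; ℤ[1/p]) = Γ₀(M) *_{Γ₀(pM)} diag(p,1)⁻¹ Γ₀(M) diag(p,1)` (Serre amalgam; TREE, proved:
`Literature.NumberTheory.EllipticCurves.Gamma0Away.gamma0Away_character_extension_of_shiftInvariant_holds`), so a character of the EDGE
group `Γ₀(pM)` extends to the amalgam iff it is DOUBLY p-OLD (pushout universal property).  `IharaModP` is the resulting restatement of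
`NonExtension`: a type-II doubly-p-old character is Eisenstein (Ihara 1975 / Ribet 1984, mod p, weight 2). -/

/-- `χ : Γ₀(pM) → F` is doubly `p`-old: `χ = π₁^* u` (restriction of a character `u` of `Γ₀(M)` along the inclusion) and
`χ = π_p^* u″` (pull-back of a character `u″` of `Γ₀(M)` along the degeneracy conjugation `γ ↦ diag(p,1) γ diag(p,1)⁻¹`,
tree `Gamma0.degeneracyConj`). -/
def IsDoublyOld {F : Type*} [Group F] (p M : ℕ) [NeZero p] (χ : Gamma0 (p * M) →* F) : Prop :=
  ∃ u u'' : Gamma0 M →* F,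
    (∀ γ : Gamma0 (p * M),
        u (Literature.NumberTheory.EllipticCurves.ModularForms.Gamma0.degeneracyConj M (p * M) 1
              (Dvd.intro p (by ring)) γ) = χ γ) ∧
    (∀ γ : Gamma0 (p * M),
        u'' (Literature.NumberTheory.EllipticCurves.ModularForms.Gamma0.degeneracyConj M (p * M) p
              (dvd_of_eq (Nat.mul_comm M p)) γ) = χ γ)

/-- **Ihara's lemma mod p, group form** (the algebraic half of the card, equivalent to `NonExtension` via the amalgam): a type-II
character of `Γ₀(pM)` with values in a finite group which is doubly `p`-old is Eisenstein. -/
def IharaModP (p M : ℕ) [NeZero p] : Prop :=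
  ∀ (F : Type) [Group F] [Finite F] (χ : Gamma0 (p * M) →* F), IsTypeII (p * M) χ → IsDoublyOld p M χ → IsEisenstein (p * M) χ

/-- The v2 first lemma: `LemmaE` (Kurth–Long 3.2 in Γ₀-form) and `IharaModP`. -/
def FirstLemmaV2 (p M : ℕ) [NeZero p] : Prop := LemmaE (p * M) ∧ IharaModP p M

example : FirstLemmaV2 5 3 ↔ LemmaE 15 ∧ IharaModP 5 3 := Iff.rfl

end Summit.BirchSwinnertonDyer.BirchSwinnertonDyer.Cruxes.UpperNonSurjFive.FwSolenoid
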